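import Literature.NumberTheory.Sieve.RoughNumbersBuchstab
import HarnessLib

/-!
# Ω-cells of the rough integers: trivial ranges and the regularity of the density weights

Topic `Literature/NumberTheory/Sieve`. Everything here is PROVED. Inputs of Alladi's asymptotic for the
`Ω`-cells `Ψ_j(X, N) = #{b ∈ roughIcc N X : Ω(b) = j}` (`RoughOmegaCellsAsymptotic.lean`) that do not
involve primes, for an abstract density family `F : ℕ → ℝ → ℝ` subject to (some of) the Alladi–Buchstab
hypotheses `F_0 ≡ 1`, `F_i` continuous on `[1, ∞)`, `F_{i+1} = 0` on `(−∞, i+2]`,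
`F_{i+1}(v) = ∫_1^{v−1} F_i(s) ds/s` (`v ≥ 2`), `F_{i+1}'(s) = F_i(s−1)/(s−1)` (`s > 2`):

* `card_roughIcc_filter_cardFactors_le_one_of_le_pow`, `…_le_self` — cells above `N^j ≥ X` have at
  most one element; `Ψ ≤ X`;
* `exists_bound_abs_density`, `density_weight_regular` — sup bounds and `C¹` regularity of the weight
  `σ_j(s) = F_j(s)/s` on the window `s ∈ [k−1, 2k+1]` of the step at level `k ≥ j+2` (which lies in
  `s > 2` when `j ≥ 1`, away from the kink of `F_1` at `s = 2`);
* `integral_density_div_eq_sub` — the recursion in integrated form;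
* `abs_cell_sub_main_le_of_lt_exp_two` (small `y < e²`), `abs_cell_sub_main_le_of_le` (`k ≤ Ω`: at most
  one element and vanishing main term) — the trivial ranges of the induction.

## References

* K. Alladi, Quart. J. Math. Oxford (2) 33 (1982), 129–148. [Alladi1982]
* G. Tenenbaum, *Introduction to analytic and probabilistic number theory*, Ch. III.6. [Tenenbaum2015]
-/

open Finset Real MeasureTheory Set
open scoped Chebyshev

noncomputable section

namespace Literature.NumberTheory.Sieve

/-! ### Elementary counts -/

/-- `N^{Ω(b)} ≤ b` for an `N`-rough `b` (every prime factor is `≥ N`; private copy of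
`RoughOmegaCells.pow_cardFactors_le_of_mem_roughIcc`, to keep this file independent of it). [folklore] -/
private theorem pow_cardFactors_le_of_mem_roughIcc' {N X b : ℕ} (hb : b ∈ roughIcc N X) :
    N ^ ArithmeticFunction.cardFactors b ≤ b := by
  rw [mem_roughIcc] at hb
  have hb0 : b ≠ 0 := by omega
  rw [ArithmeticFunction.cardFactors_apply]
  conv_rhs => rw [← Nat.prod_primeFactorsList hb0]
  exact List.pow_card_le_prod _ _ fun p hp =>
    hb.2 p (Nat.prime_of_mem_primeFactorsList hp) (Nat.dvd_of_mem_primeFactorsList hp)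

/-- If `X ≤ N ^ j` and `j ≥ 1`… in fact for any `j`: every element `b` of the `Ω = j` cell of
`roughIcc N X` satisfies `N^j ≤ b ≤ X ≤ N^j`, so the cell has at most one element. [folklore] -/
theorem card_roughIcc_filter_cardFactors_le_one_of_le_pow {N X j : ℕ} (h : X ≤ N ^ j) :
    ((roughIcc N X).filter (fun b => ArithmeticFunction.cardFactors b = j)).card ≤ 1 := by
  rw [Finset.card_le_one]
  intro a ha b hb
  rw [Finset.mem_filter] at ha hb
  have ha1 := pow_cardFactors_le_of_mem_roughIcc' ha.1
  have hb1 := pow_cardFactors_le_of_mem_roughIcc' hb.1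
  rw [ha.2] at ha1
  rw [hb.2] at hb1
  have haX : a ≤ X := (Finset.mem_Icc.mp (roughIcc_subset_Icc _ _ ha.1)).2
  have hbX : b ≤ X := (Finset.mem_Icc.mp (roughIcc_subset_Icc _ _ hb.1)).2
  omega

/-- The trivial bound `Ψ ≤ X`. [folklore] -/
theorem card_roughIcc_filter_cardFactors_le_self (N X j : ℕ) :
    ((roughIcc N X).filter (fun b => ArithmeticFunction.cardFactors b = j)).card ≤ X := by
  calc _ ≤ (roughIcc N X).card := Finset.card_filter_le _ _
    _ ≤ (Finset.Icc 1 X).card := Finset.card_le_card (roughIcc_subset_Icc _ _)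
    _ = X := by simp

/-! ### Regularity of the weights `σ_i(s) = F_i(s)/s` from the Alladi–Buchstab recursion -/

/-- A bound for `|F_i|` on a compact interval of `[1, ∞)` (continuity). [folklore] -/
theorem exists_bound_abs_density {F : ℕ → ℝ → ℝ} (hFc : ∀ i, ContinuousOn (F i) (Set.Ici 1))
    (i : ℕ) (T : ℝ) : ∃ B : ℝ, 0 ≤ B ∧ ∀ s ∈ Set.Icc (1 : ℝ) T, |F i s| ≤ B := by
  obtain ⟨B, hB⟩ := isCompact_Icc.exists_bound_of_continuousOn
    ((hFc i).mono (Set.Icc_subset_Ici_self : Set.Icc (1 : ℝ) T ⊆ Set.Ici 1))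
  refine ⟨max B 0, le_max_right _ _, fun s hs => ?_⟩
  have h := hB s hs
  rw [Real.norm_eq_abs] at h
  exact h.trans (le_max_left _ _)

/-- **Regularity of the weight `σ_j(s) = F_j(s)/s` on the window `s ∈ [k−1, 2k+1]`** used by the step
at level `k ≥ j + 2`: continuity, a derivative on the half-open window with a continuous and bounded
derivative, and a sup bound (`F_0 ≡ 1`; for `j ≥ 1` the window lies in `s > 2` where
`F_j' (s) = F_{j−1}(s−1)/(s−1)`). [folklore] -/
theorem density_weight_regular {F : ℕ → ℝ → ℝ} (hF0 : ∀ s, F 0 s = 1)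
    (hFc : ∀ i, ContinuousOn (F i) (Set.Ici 1))
    (hFd : ∀ i (s : ℝ), 2 < s → HasDerivAt (F (i + 1)) (F i (s - 1) / (s - 1)) s)
    (j k : ℕ) (hk : j + 2 ≤ k) :
    ∃ B B' : ℝ, ∃ σ' : ℝ → ℝ, 0 ≤ B ∧ 0 ≤ B' ∧
      ContinuousOn (fun s => F j s / s) (Set.Icc ((k : ℝ) - 1) (2 * k + 1)) ∧
      (∀ s : ℝ, (k : ℝ) - 1 < s → s ≤ 2 * k + 1 → HasDerivAt (fun s => F j s / s) (σ' s) s) ∧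
      ContinuousOn σ' (Set.Ioc ((k : ℝ) - 1) (2 * k + 1)) ∧
      (∀ s : ℝ, (k : ℝ) - 1 ≤ s → s ≤ 2 * k + 1 → |F j s / s| ≤ B) ∧
      (∀ s : ℝ, (k : ℝ) - 1 < s → s ≤ 2 * k + 1 → |σ' s| ≤ B') := by
  have hk2 : (2 : ℝ) ≤ k := by
    have : 2 ≤ k := le_trans (Nat.le_add_left 2 j) hk
    exact_mod_cast this
  have hk1 : (1 : ℝ) ≤ (k : ℝ) - 1 := by linarith
  -- continuity of `σ_j` on the closed window (common to both cases)
  have hcont : ContinuousOn (fun s => F j s / s) (Set.Icc ((k : ℝ) - 1) (2 * k + 1)) := by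
    refine ContinuousOn.div ((hFc j).mono fun s hs => ?_) continuousOn_id fun s hs => ?_
    · exact le_trans hk1 hs.1
    · have : (1 : ℝ) ≤ s := le_trans hk1 hs.1
      exact ne_of_gt (by linarith)
  -- sup bound of `σ_j` (from a bound of `F_j` on `[1, 2k+1]`)
  obtain ⟨B, hB0, hB⟩ := exists_bound_abs_density hFc j (2 * k + 1)
  have hbound : ∀ s : ℝ, (k : ℝ) - 1 ≤ s → s ≤ 2 * k + 1 → |F j s / s| ≤ B := by
    intro s hs1 hs2
    have hs0 : 1 ≤ s := hk1.trans hs1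
    rw [abs_div, abs_of_pos (by linarith : (0 : ℝ) < s)]
    calc |F j s| / s ≤ |F j s| / 1 := div_le_div_of_nonneg_left (abs_nonneg _) one_pos hs0
      _ = |F j s| := div_one _
      _ ≤ B := hB s ⟨hs0, hs2⟩
  rcases j with _ | j
  · -- `j = 0`: `σ_0(s) = 1/s`, `σ_0'(s) = -1/s²`
    refine ⟨B, 1, fun s => -(s ^ 2)⁻¹, hB0, zero_le_one, hcont, ?_, ?_, hbound, ?_⟩
    · intro s hs1 _
      have hs0 : (0 : ℝ) < s := by linarith
      have hfun : (fun s => F 0 s / s) = fun s => s⁻¹ := by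
        funext t; rw [hF0 t, one_div]
      rw [hfun]
      simpa using hasDerivAt_inv hs0.ne'
    · refine ContinuousOn.neg (ContinuousOn.inv₀ (continuousOn_pow 2) fun s hs => ?_)
      have : (0 : ℝ) < s := by linarith [hs.1]
      positivity
    · intro s hs1 _
      have hs0 : (1 : ℝ) ≤ s := by linarith
      rw [abs_neg, abs_inv, abs_of_pos (by positivity : (0 : ℝ) < s ^ 2)]
      exact inv_le_one_of_one_le₀ (by nlinarith)
  · -- `j + 1 ≥ 1`: the window lies in `s > 2`
    obtain ⟨B₁, hB₁0, hB₁⟩ := exists_bound_abs_density hFc j (2 * k + 1)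
    have hk3 : (3 : ℝ) ≤ k := by
      have : 3 ≤ k := le_trans (by omega) hk
      exact_mod_cast this
    set σ' : ℝ → ℝ := fun s => (F j (s - 1) / (s - 1) * s - F (j + 1) s * 1) / s ^ 2 with hσ'
    refine ⟨B, B₁ + B, σ', hB0, by positivity, hcont, ?_, ?_, hbound, ?_⟩
    · intro s hs1 _
      have hs2 : (2 : ℝ) < s := by linarith
      have hs0 : s ≠ 0 := by positivity
      have h := (hFd j s hs2).div (hasDerivAt_id' s) hs0
      exact h
    · -- continuity of `σ'` on the half-open window
      have hFj : ContinuousOn (fun s : ℝ => F j (s - 1)) (Set.Ioc ((k : ℝ) - 1) (2 * k + 1)) := by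
        refine (hFc j).comp (continuousOn_id.sub continuousOn_const) fun s hs => ?_
        simp only [Set.mem_Ici]
        linarith [hs.1]
      have hFj1 : ContinuousOn (fun s : ℝ => F (j + 1) s) (Set.Ioc ((k : ℝ) - 1) (2 * k + 1)) :=
        (hFc (j + 1)).mono fun s hs => by simp only [Set.mem_Ici]; linarith [hs.1]
      rw [hσ']
      refine ContinuousOn.div ?_ (continuousOn_pow 2) fun s hs => ?_
      · refine ContinuousOn.sub (ContinuousOn.mul (ContinuousOn.div hFj
          (continuousOn_id.sub continuousOn_const) fun s hs => ?_) continuousOn_id)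
          (hFj1.mul continuousOn_const)
        have : (2 : ℝ) < s := by linarith [hs.1]
        linarith
      · have : (2 : ℝ) < s := by linarith [hs.1]
        positivity
    · intro s hs1 hs2
      have hs2' : (2 : ℝ) < s := by linarith
      have hs1' : (1 : ℝ) ≤ s - 1 := by linarith
      have hFjs : |F j (s - 1)| ≤ B₁ := hB₁ (s - 1) ⟨hs1', by linarith⟩
      have hFj1s : |F (j + 1) s| ≤ B := hB s ⟨by linarith, hs2⟩
      rw [hσ']
      simp only [mul_one]
      rw [abs_div, abs_of_pos (by positivity : (0 : ℝ) < s ^ 2), div_le_iff₀ (by positivity)]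
      have h1 : |F j (s - 1) / (s - 1) * s| ≤ B₁ * s := by
        rw [abs_mul, abs_of_pos (by linarith : (0 : ℝ) < s), abs_div,
          abs_of_pos (by linarith : (0 : ℝ) < s - 1)]
        refine mul_le_mul_of_nonneg_right ?_ (by linarith)
        calc |F j (s - 1)| / (s - 1) ≤ |F j (s - 1)| / 1 :=
              div_le_div_of_nonneg_left (abs_nonneg _) one_pos hs1'
          _ ≤ B₁ := by rw [div_one]; exact hFjs
      have h2 : |F (j + 1) s| ≤ B := hFj1s
      calc |F j (s - 1) / (s - 1) * s - F (j + 1) s|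
          ≤ |F j (s - 1) / (s - 1) * s| + |F (j + 1) s| := abs_sub _ _
        _ ≤ B₁ * s + B := add_le_add h1 h2
        _ ≤ (B₁ + B) * s ^ 2 := by
            have e1 : B₁ * s ≤ B₁ * s ^ 2 :=
              mul_le_mul_of_nonneg_left (by nlinarith : s ≤ s ^ 2) hB₁0
            have e2 : B ≤ B * s ^ 2 := le_mul_of_one_le_right hB0 (by nlinarith : 1 ≤ s ^ 2)
            nlinarith

/-- **The recursion in integrated form**: `∫_{k−1}^{v−1} F_i(s) ds/s = F_{i+1}(v) − F_{i+1}(k)` for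
`2 ≤ k ≤ v` (difference of the defining integrals `F_{i+1}(w) = ∫_1^{w−1} F_i(s) ds/s`). [folklore] -/
theorem integral_density_div_eq_sub {F : ℕ → ℝ → ℝ} (hFc : ∀ i, ContinuousOn (F i) (Set.Ici 1))
    (hFrec : ∀ i (v : ℝ), 2 ≤ v → F (i + 1) v = ∫ s in (1 : ℝ)..(v - 1), F i s / s)
    (i : ℕ) {k v : ℝ} (hk : 2 ≤ k) (hkv : k ≤ v) :
    ∫ s in (k - 1)..(v - 1), F i s / s = F (i + 1) v - F (i + 1) k := by
  have hint : ∀ w : ℝ, 1 ≤ w → IntervalIntegrable (fun s => F i s / s) volume 1 w := by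
    intro w hw
    refine (ContinuousOn.div ((hFc i).mono ?_) continuousOn_id ?_).intervalIntegrable
    · intro s hs
      rw [Set.uIcc_of_le hw] at hs
      exact hs.1
    · intro s hs
      rw [Set.uIcc_of_le hw] at hs
      have : (1 : ℝ) ≤ s := hs.1
      exact ne_of_gt (by simp only [id]; linarith)
  rw [hFrec i v (by linarith), hFrec i k hk,
    ← intervalIntegral.integral_interval_sub_left (hint (v - 1) (by linarith)) (hint (k - 1) (by linarith))]

/-! ### The trivial ranges: small `y`, and `k` at most the number of prime factors -/

/-- `log² y ≤ 4x` for `1 ≤ y ≤ x` (`log √y ≤ √y − 1`). [folklore] -/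
theorem log_sq_le_four_mul_of_one_le {x y : ℝ} (hy : 1 ≤ y) (hyx : y ≤ x) : Real.log y ^ 2 ≤ 4 * x := by
  have hy0 : 0 < y := by linarith
  have hly : 0 ≤ Real.log y := Real.log_nonneg hy
  have hs0 : 0 < Real.sqrt y := Real.sqrt_pos.mpr hy0
  have h1 : Real.log (Real.sqrt y) ≤ Real.sqrt y - 1 := Real.log_le_sub_one_of_pos hs0
  have h2 : Real.log y = 2 * Real.log (Real.sqrt y) := by rw [Real.log_sqrt hy0.le]; ring
  have h4 : Real.log y ≤ 2 * Real.sqrt y := by linarith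
  calc Real.log y ^ 2 ≤ (2 * Real.sqrt y) ^ 2 := pow_le_pow_left₀ hly h4 2
    _ = 4 * y := by rw [mul_pow, Real.sq_sqrt hy0.le]; norm_num
    _ ≤ 4 * x := by linarith

/-- **Small `y`** (`2 ≤ y < e²`): the trivial bound `|Ψ − x F_{i+1}(u)/log x| ≤ (1 + 2B) x ≤ (4 + 8B) x/log² y`
whenever `|F_{i+1}(u)| ≤ B`. [folklore] -/
theorem abs_cell_sub_main_le_of_lt_exp_two {F : ℕ → ℝ → ℝ} {i : ℕ} {B x y : ℝ} (hB0 : 0 ≤ B)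
    (hy : 2 ≤ y) (hyx : y ≤ x) (hy2 : y < Real.exp 2)
    (hB : |F (i + 1) (Real.log x / Real.log y)| ≤ B) :
    |((((roughIcc ⌈y⌉₊ ⌊x⌋₊).filter
        (fun b => ArithmeticFunction.cardFactors b = i + 1 + 1)).card : ℕ) : ℝ) -
      x * F (i + 1) (Real.log x / Real.log y) / Real.log x| ≤ (4 + 8 * B) * x / Real.log y ^ 2 := by
  have hx0 : 0 < x := by linarith
  have hy0 : 0 < y := by linarith
  have hl2 : (1 : ℝ) / 2 < Real.log 2 := by have := Real.log_two_gt_d9; linarith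
  have hly : Real.log 2 ≤ Real.log y := Real.log_le_log two_pos hy
  have hlx : Real.log y ≤ Real.log x := Real.log_le_log hy0 hyx
  have hly0 : 0 < Real.log y := by linarith
  have hlx0 : 0 < Real.log x := by linarith
  have hly2 : Real.log y < 2 := by rw [Real.log_lt_iff_lt_exp hy0]; exact hy2
  have hΨ : ((((roughIcc ⌈y⌉₊ ⌊x⌋₊).filter
      (fun b => ArithmeticFunction.cardFactors b = i + 1 + 1)).card : ℕ) : ℝ) ≤ x := by
    calc _ ≤ ((⌊x⌋₊ : ℕ) : ℝ) := by exact_mod_cast card_roughIcc_filter_cardFactors_le_self _ _ _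
      _ ≤ x := Nat.floor_le hx0.le
  have hΨ0 : (0 : ℝ) ≤ ((((roughIcc ⌈y⌉₊ ⌊x⌋₊).filter
      (fun b => ArithmeticFunction.cardFactors b = i + 1 + 1)).card : ℕ) : ℝ) := Nat.cast_nonneg _
  have hM : |x * F (i + 1) (Real.log x / Real.log y) / Real.log x| ≤ 2 * B * x := by
    rw [abs_div, abs_mul, abs_of_pos hx0, abs_of_pos hlx0, div_le_iff₀ hlx0]
    calc x * |F (i + 1) (Real.log x / Real.log y)| ≤ x * B := by gcongr
      _ = 2 * B * x * (1 / 2) := by ring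
      _ ≤ 2 * B * x * Real.log x := by gcongr; linarith
  have hsq : Real.log y ^ 2 < 4 := by nlinarith
  calc _ ≤ |((((roughIcc ⌈y⌉₊ ⌊x⌋₊).filter
        (fun b => ArithmeticFunction.cardFactors b = i + 1 + 1)).card : ℕ) : ℝ)| +
        |x * F (i + 1) (Real.log x / Real.log y) / Real.log x| := abs_sub _ _
    _ ≤ x + 2 * B * x := by rw [abs_of_nonneg hΨ0]; exact add_le_add hΨ hM
    _ = (1 + 2 * B) * x := by ring
    _ ≤ (4 + 8 * B) * x / Real.log y ^ 2 := by
        rw [le_div_iff₀ (by positivity)]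
        have : 0 ≤ (1 + 2 * B) * x := by positivity
        nlinarith

/-- **`k` at most the number of prime factors**: for `log x ≤ k log y` with `k ≤ i + 2`, the
`Ω = i+2` cell of the `⌈y⌉`-rough integers up to `x` has at most one element (each is `≥ y^{i+2} ≥ x`)
and the main term vanishes (`F_{i+1}(u) = 0` for `u ≤ i+2`), so the error is `≤ 1 ≤ 4x/log² y`.
[folklore] -/
theorem abs_cell_sub_main_le_of_le {F : ℕ → ℝ → ℝ} (hFz : ∀ (i : ℕ) (v : ℝ), v ≤ (i : ℝ) + 2 → F (i + 1) v = 0)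
    {i k : ℕ} (hki : k ≤ i + 2) {x y : ℝ} (hy : 2 ≤ y) (hyx : y ≤ x)
    (hxy : Real.log x ≤ k * Real.log y) :
    |((((roughIcc ⌈y⌉₊ ⌊x⌋₊).filter
        (fun b => ArithmeticFunction.cardFactors b = i + 1 + 1)).card : ℕ) : ℝ) -
      x * F (i + 1) (Real.log x / Real.log y) / Real.log x| ≤ 4 * x / Real.log y ^ 2 := by
  have hx0 : 0 < x := by linarith
  have hy0 : 0 < y := by linarith
  have hy1 : (1 : ℝ) ≤ y := by linarith
  have hly0 : 0 < Real.log y := Real.log_pos (by linarith)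
  -- the main term vanishes
  have hu : Real.log x / Real.log y ≤ (i : ℝ) + 2 := by
    rw [div_le_iff₀ hly0]
    calc Real.log x ≤ k * Real.log y := hxy
      _ ≤ ((i : ℝ) + 2) * Real.log y := by
          gcongr
          exact_mod_cast hki
  rw [hFz i _ hu, mul_zero, zero_div, sub_zero]
  -- the cell has at most one element: `⌊x⌋ ≤ ⌈y⌉^{i+2}`
  have hxpow : x ≤ y ^ k := by
    have h1 : x = Real.exp (Real.log x) := (Real.exp_log hx0).symm
    rw [h1]
    calc Real.exp (Real.log x) ≤ Real.exp (k * Real.log y) := Real.exp_le_exp.mpr hxy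
      _ = y ^ k := by rw [Real.exp_nat_mul, Real.exp_log hy0]
  have hXN : ⌊x⌋₊ ≤ ⌈y⌉₊ ^ (i + 2) := by
    have h1 : (⌊x⌋₊ : ℝ) ≤ x := Nat.floor_le hx0.le
    have h2 : y ^ k ≤ y ^ (i + 2) := pow_le_pow_right₀ hy1 hki
    have h3 : y ^ (i + 2) ≤ (⌈y⌉₊ : ℝ) ^ (i + 2) := pow_le_pow_left₀ hy0.le (Nat.le_ceil y) _
    have h4 : (⌊x⌋₊ : ℝ) ≤ ((⌈y⌉₊ ^ (i + 2) : ℕ) : ℝ) := by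
      push_cast
      linarith
    exact_mod_cast h4
  have hcard := card_roughIcc_filter_cardFactors_le_one_of_le_pow (N := ⌈y⌉₊) (j := i + 1 + 1)
    (by simpa [add_assoc] using hXN)
  have hcard' : ((((roughIcc ⌈y⌉₊ ⌊x⌋₊).filter
      (fun b => ArithmeticFunction.cardFactors b = i + 1 + 1)).card : ℕ) : ℝ) ≤ 1 := by
    exact_mod_cast hcard
  rw [abs_of_nonneg (Nat.cast_nonneg _)]
  have hsq := log_sq_le_four_mul_of_one_le hy1 hyx
  calc _ ≤ (1 : ℝ) := hcard'
    _ ≤ 4 * x / Real.log y ^ 2 := by rw [le_div_iff₀ (by positivity)]; linarith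

end Literature.NumberTheory.Sieve

end
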